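import Summits.BirchSwinnertonDyer.Rank1Residual.GaloisImage.KolyvaginCoreVertices
import Summits.BirchSwinnertonDyer.Rank1Residual.GaloisImage.TransverseOrthogonal
import Summits.BirchSwinnertonDyer.Rank1Residual.GaloisImage.KolyvaginPrimeLocalShapeRatHolds
import HarnessLib

/-!
# The cyclotomic transverse condition is self-dual under the residual self-duality `θ`
# (Mazur–Rubin Prop. 1.3.2 (ii) / Rubin PCMI Prop. 1.9.5 (4), read through `θ : T̄ ⥲ T̄^D`) — the
# binder `hTθ` of the core-graph files DISCHARGED
# (cell `b2b-bsdres`, team n1011, row T-R1-56-G, file G6; seat p11; skeleton `cells/n1011/skel/T-R1-56-G.md`)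

HONEST FRAMING (verbatim for the cell): research route; prove what is provable now; no claim beyond
stated classes; nothing booked; no mark / label moved.  TOOL theorems, no definition, no named fact.

The core-graph files `KolyvaginCore*.lean` (row T-R1-56-G) carry the hypothesis
`hTθ : ∀ q ∈ 𝒫, (𝒯_q^*).comap θ_q = 𝒯_q` — "the transverse condition at the Kolyvagin primes is
self-dual under the residual self-duality `θ`" — needed to compare the transported dual Selmer group
`H†(n)` with `H(n)` at the primes of the level `n` (Sakamoto §3.1.2: "by using this 𝔽[G_K]-isomorphism,
we regard `𝓕^*` as a Selmer structure on `T̄`").  For the CYCLOTOMIC transverse condition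
`𝒯_q = H¹_tr(K_q, M) = ker(H¹(K_q, M) → H¹(K_q(μ_{Nq}), M))` (Mazur–Rubin Def. 1.1.6, the tree's
`cyclotomicTransverse`) it follows from
* Mazur–Rubin Prop. 1.3.2 (ii) "`H¹_tr(K,T)` and `H¹_tr(K,T^*)` are orthogonal complements" — in the
  tree the predicate `LocalInvariants.TransverseOrthogonal`, a THEOREM at odd `n` for every perfect
  family (`TransverseCup.transverseOrthogonal_of_isPerfect_of_odd`, row T-M2p-K, p04); and
* functoriality: an equivariant `θ : M → M^D` with inverse `θ′` carries `H¹_tr(K_q, M)` onto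
  `H¹_tr(K_q, M^D)` (restriction to `K_q(μ_ℓ)` commutes with the change of coefficients).
§19 proves this for a general number field `K` under the per-prime hypotheses of
`TransverseOrthogonal` (`Nq = ℓ` prime, `q ∤ n`, `M` unramified at `q`, `(ℓ − 1)M = 0`, `χ̄_ℓ` onto on
inertia), and §20 reads it over `ℚ` at Sakamoto's `τ`-class primes `frobeniusClassPrimes ρ S τ N`
(`N ∣ Nq − 1` as `τ` fixes `μ_N`, p18 `absNorm_sub_one_smul_eq_zero_of_mem_frobeniusClassPrimes`;
`χ̄_ℓ` onto on `I_{ℚ_ℓ}`, `modPCyclotomicCharacter_surjOn_absInertia_rat_holds`) — the shape consumed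
by the `m = 1` assembly of [S24] Thm. 4.4 (1) (row T-R1-56-S FILE F).

References: B. Mazur, K. Rubin, Mem. AMS 799 (2004), Def. 1.1.6, Prop. 1.3.2 (ii) (cited through
the tree's `PoitouTateTransverseDuality.lean`; not held); [Rubin2011] Prop. 1.9.5 (4) (p. 14);
[Sakamoto2024] §3.1.2 (p. 924), §2 (the set 𝒫, pp. 920–921).
-/

noncomputable section

open scoped Classical NumberField ContRepresentation
open Function NumberField IsDedekindDomain
open Literature.NumberTheory.GaloisRepresentations Literature.NumberTheory.GaloisRepresentations.DiscreteGaloisModule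
  Literature.NumberTheory.GaloisCohomology
open Summit.BirchSwinnertonDyer.Rank1Residual.GaloisImage.CoreRankZero
open Summit.BirchSwinnertonDyer.Rank1Residual.X11b.Levels

universe u

namespace Summit.BirchSwinnertonDyer.Rank1Residual.GaloisImage.CoreRankOne

/-! ## §19. Transverse classes under a change of coefficients; the `θ`-self-duality of `H¹_tr` -/

section Local

variable {F : Type u} [Field F] {M₁ M₂ : Type u}
  [AddCommGroup M₁] [TopologicalSpace M₁] [DiscreteTopology M₁]
  [AddCommGroup M₂] [TopologicalSpace M₂] [DiscreteTopology M₂]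
  {ρ₁ : DiscreteGaloisModule F M₁} {ρ₂ : DiscreteGaloisModule F M₂}

/-- **Intertwining maps preserve transverse classes**: `H¹(f)` maps `H¹_tr(F, M₁) = ker(H¹(F,M₁) →
H¹(L,M₁))` into `H¹_tr(F, M₂)` (restriction to `L` commutes with the change of coefficients,
`galoisCohomology.res_map_one`; the sibling of X11b `map_mem_unramifiedSubgroup`).
[cite: Rubin2011, Def. 1.9.4 (p. 14)] -/
theorem map_mem_transverseSubgroup (L : Type u) [Field L] [Algebra F L]
    (f : ρ₁.toContRepresentation →ⁱL ρ₂.toContRepresentation) {c : galoisCohomology ρ₁ 1}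
    (hc : c ∈ transverseSubgroup ρ₁ L) : galoisCohomology.map f 1 c ∈ transverseSubgroup ρ₂ L := by
  rw [DiscreteGaloisModule.mem_transverseSubgroup_iff] at hc ⊢
  rw [galoisCohomology.res_map_one, hc, map_zero]

end Local

variable {K : Type u} [Field K] [NumberField K]
variable {M : Type u} [AddCommGroup M] [TopologicalSpace M] [DiscreteTopology M] [Finite M]
variable {ρ : DiscreteGaloisModule K M}

section Theta

variable {p : ℕ} (θ : ρ.toContRepresentation →ⁱL (ρ.tateDual p).toContRepresentation)
  (θ' : (ρ.tateDual p).toContRepresentation →ⁱL ρ.toContRepresentation)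

/-- **`θ_q^{-1}(H¹_tr(K_q, M^D)) = H¹_tr(K_q, M)`** for the cyclotomic transverse conditions
(`L = K_q(μ_{Nq})`) and an equivariant `θ : M → M^D` with left inverse `θ′`.
[cite: Rubin2011, Def. 1.9.4 (p. 14)] -/
theorem comap_cyclotomicTransverse_tateDual_eq (hθθ' : ∀ a : M, θ' (θ a) = a)
    (q : HeightOneSpectrum (𝓞 K)) :
    (cyclotomicTransverse (ρ.tateDual p) (Sum.inr q)).comap (localMap θ (Sum.inr q)) =
      cyclotomicTransverse ρ (Sum.inr q) := by
  rw [cyclotomicTransverse_inr, cyclotomicTransverse_inr]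
  ext x
  rw [AddSubgroup.mem_comap]
  refine ⟨fun hx => ?_, fun hx => ?_⟩
  · have h := map_mem_transverseSubgroup (ρ₁ := GaloisRep.toLocal q (ρ.tateDual p))
      (ρ₂ := GaloisRep.toLocal q ρ) (CyclotomicField (Ideal.absNorm q.asIdeal) (q.adicCompletion K))
      (θ'.restrictField (q.adicCompletion K)) hx
    have h' := localMap_localMap_eq_self θ θ' hθθ' (Sum.inr q) x
    change localMap θ' (Sum.inr q) (localMap θ (Sum.inr q) x) ∈
      transverseSubgroup (GaloisRep.toLocal q ρ)
        (CyclotomicField (Ideal.absNorm q.asIdeal) (q.adicCompletion K)) at h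
    rwa [h'] at h
  · exact map_mem_transverseSubgroup (ρ₁ := GaloisRep.toLocal q ρ) (ρ₂ := GaloisRep.toLocal q (ρ.tateDual p))
      (CyclotomicField (Ideal.absNorm q.asIdeal) (q.adicCompletion K)) (θ.restrictField (q.adicCompletion K)) hx

/-- **The cyclotomic transverse condition is `θ`-self-dual** (Mazur–Rubin Prop. 1.3.2 (ii) through
`θ`): under `TransverseOrthogonal` (a theorem at odd `n`) and its per-prime hypotheses at `q`
(`Nq` prime, `q ∤ p`, `M` unramified at `q` and killed by `Nq − 1`, `χ̄_{Nq}` onto on inertia),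
`θ_q^{-1}((H¹_tr(K_q, M))^*) = H¹_tr(K_q, M)`. [cite: Rubin2011, Prop. 1.9.5 (4) (p. 14)]
[cite: Sakamoto2024, §3.1.2 (p. 924)] -/
theorem comap_dualLocalCondition_cyclotomicTransverse_eq {inv : LocalInvariants K p}
    (hTr : inv.TransverseOrthogonal) (hM : ∀ m : M, p • m = 0) (hθθ' : ∀ a : M, θ' (θ a) = a)
    (q : HeightOneSpectrum (𝓞 K)) [Fact (Ideal.absNorm q.asIdeal).Prime]
    [NeZero ((Ideal.absNorm q.asIdeal : ℕ) : q.adicCompletion K)]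
    (hq : ((p : ℕ) : 𝓞 K) ∉ q.asIdeal) (hur : GaloisRep.IsUnramifiedAt q ρ)
    (hM' : ∀ m : M, (Ideal.absNorm q.asIdeal - 1) • m = 0)
    (hχI : ∀ u : (ZMod (Ideal.absNorm q.asIdeal))ˣ, ∃ t ∈ absInertia (q.adicCompletion K),
      modPCyclotomicCharacterZMod (q.adicCompletion K) (Ideal.absNorm q.asIdeal) t = u) :
    (inv.dualLocalCondition ρ (Sum.inr q) (cyclotomicTransverse ρ (Sum.inr q))).comap
        (localMap θ (Sum.inr q)) = cyclotomicTransverse ρ (Sum.inr q) := by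
  rw [hTr.dualLocalCondition_cyclotomicTransverse_absNorm ρ hM q hq hur hM' hχI]
  exact comap_cyclotomicTransverse_tateDual_eq θ θ' hθθ' q

/-- **The binder `hTθ` of the core-graph files, for a datum with the cyclotomic transverse
conditions** (general number field): at every `q ∈ 𝒫` satisfying the per-prime hypotheses,
`θ_q^{-1}(𝒯_q^*) = 𝒯_q`. [cite: Rubin2011, Prop. 1.9.5 (4) (p. 14)] [cite: Sakamoto2024, §3.1.2 (p. 924)] -/
theorem comap_dualLocalCondition_transverse_eq_of_transverse_eq {inv : LocalInvariants K p}
    (hTr : inv.TransverseOrthogonal) (hM : ∀ m : M, p • m = 0) (hθθ' : ∀ a : M, θ' (θ a) = a)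
    {D : KolyvaginDatum ρ} (hT : D.transverse = cyclotomicTransverse ρ)
    (hprime : ∀ q ∈ D.primes, (Ideal.absNorm q.asIdeal).Prime)
    (hne : ∀ q ∈ D.primes, ((Ideal.absNorm q.asIdeal : ℕ) : q.adicCompletion K) ≠ 0)
    (hpq : ∀ q ∈ D.primes, ((p : ℕ) : 𝓞 K) ∉ q.asIdeal ∧ GaloisRep.IsUnramifiedAt q ρ)
    (hM' : ∀ q ∈ D.primes, ∀ m : M, (Ideal.absNorm q.asIdeal - 1) • m = 0)
    (hχI : ∀ q ∈ D.primes, ∀ [Fact (Ideal.absNorm q.asIdeal).Prime]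
      [NeZero ((Ideal.absNorm q.asIdeal : ℕ) : q.adicCompletion K)],
      ∀ u : (ZMod (Ideal.absNorm q.asIdeal))ˣ, ∃ t ∈ absInertia (q.adicCompletion K),
        modPCyclotomicCharacterZMod (q.adicCompletion K) (Ideal.absNorm q.asIdeal) t = u) :
    ∀ q ∈ D.primes, (inv.dualLocalCondition ρ (Sum.inr q) (D.transverse (Sum.inr q))).comap
      (localMap θ (Sum.inr q)) = D.transverse (Sum.inr q) := by
  intro q hqP
  haveI : Fact (Ideal.absNorm q.asIdeal).Prime := ⟨hprime q hqP⟩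
  haveI : NeZero ((Ideal.absNorm q.asIdeal : ℕ) : q.adicCompletion K) := ⟨hne q hqP⟩
  rw [hT]
  exact comap_dualLocalCondition_cyclotomicTransverse_eq θ θ' hTr hM hθθ' q (hpq q hqP).1 (hpq q hqP).2
    (hM' q hqP) (hχI q hqP)

end Theta

/-! ## §20. The reading over `ℚ` at Sakamoto's `τ`-class primes -/

section Rat

variable {M : Type} [AddCommGroup M] [TopologicalSpace M] [DiscreteTopology M] [Finite M]
  {ρ : DiscreteGaloisModule ℚ M} {p : ℕ}
  (θ : ρ.toContRepresentation →ⁱL (ρ.tateDual p).toContRepresentation)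
  (θ' : (ρ.tateDual p).toContRepresentation →ⁱL ρ.toContRepresentation)

/-- **`hTθ` over `ℚ` at the `τ`-class primes, from a perfect family at odd `p`**: for a finite
discrete `Γ_ℚ`-module `M` killed by `p` (odd) and by `N`, `τ` fixing `μ_N`, a Kolyvagin datum with
primes `frobeniusClassPrimes ρ S₀ τ N` lying outside `S` (`p ∉ q`, `M` unramified at `q` for
`q ∉ S`) and the cyclotomic transverse conditions, and `θ : M → M^D` with left inverse `θ′`: at every
`q ∈ 𝒫`, `θ_q^{-1}(𝒯_q^*) = 𝒯_q` — `TransverseOrthogonal` holds for every perfect family at odd `p`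
(T-M2p-K), `(Nq − 1)M = 0` as `N ∣ Nq − 1` (p18), and `χ̄_{Nq}` is onto on `I_{ℚ_{Nq}}` (Serre LF IV
§4 Prop. 17, the tree's `modPCyclotomicCharacter_surjOn_absInertia_rat_holds`).
[cite: Rubin2011, Prop. 1.9.5 (4) (p. 14)] [cite: Sakamoto2024, §2 (pp. 920–921) and §3.1.2 (p. 924)] -/
theorem comap_dualLocalCondition_transverse_eq_rat {inv : LocalInvariants ℚ p} (hodd : Odd p)
    (hperf : inv.IsPerfect) (hur : inv.UnramifiedOrthogonal) (hM : ∀ m : M, p • m = 0)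
    (hθθ' : ∀ a : M, θ' (θ a) = a) {S : Finset (Place ℚ)}
    (hS : ∀ v : HeightOneSpectrum (𝓞 ℚ), (Sum.inr v : Place ℚ) ∉ S →
      ((p : ℕ) : 𝓞 ℚ) ∉ v.asIdeal ∧ GaloisRep.IsUnramifiedAt v ρ)
    {D : KolyvaginDatum ρ} (hPS : ∀ q ∈ D.primes, (Sum.inr q : Place ℚ) ∉ S)
    {S₀ : Set (HeightOneSpectrum (𝓞 ℚ))} {τ : Field.absoluteGaloisGroup ℚ} {N : ℕ} [NeZero N]
    (hP : D.primes = frobeniusClassPrimes ρ S₀ τ N) (hT : D.transverse = cyclotomicTransverse ρ)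
    (hτ : τ ∈ rootsOfUnityFixer ℚ N) (hMN : ∀ m : M, N • m = 0) :
    ∀ q ∈ D.primes, (inv.dualLocalCondition ρ (Sum.inr q) (D.transverse (Sum.inr q))).comap
      (localMap θ (Sum.inr q)) = D.transverse (Sum.inr q) := by
  refine comap_dualLocalCondition_transverse_eq_of_transverse_eq θ θ'
    (TransverseCup.transverseOrthogonal_of_isPerfect_of_odd inv hodd hperf hur) hM hθθ' hT
    (fun q _ => Literature.NumberTheory.Automorphic.Ash2003.residueCard_prime q) (fun q _ => ?_) (fun q hq => hS q (hPS q hq))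
    (fun q hq => absNorm_sub_one_smul_eq_zero_of_mem_frobeniusClassPrimes ρ (hP ▸ hq) hτ hMN)
    (fun q _ _ _ u => modPCyclotomicCharacter_surjOn_absInertia_rat_holds q u)
  haveI : CharZero (q.adicCompletion ℚ) :=
    charZero_of_injective_algebraMap (algebraMap ℚ (q.adicCompletion ℚ)).injective
  exact Nat.cast_ne_zero.2 (Literature.NumberTheory.Automorphic.Ash2003.residueCard_prime q).ne_zero

end Rat

end Summit.BirchSwinnertonDyer.Rank1Residual.GaloisImage.CoreRankOne

end
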